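import Summits.QuantumFields.GaugeBoot.TiltedLatticeAxisReversal
import Summits.QuantumFields.GaugeBoot.TiltedBoxSiteRP
import Summits.QuantumFields.GaugeBoot.TiltedBox
import HarnessLib

/-!
# Anti-diagonal reflection positivity on EVERY 45°-tilted periodic box (gauge-boot, L3 supplement; tribunal A6(iii))

HONEST FRAMING (cell `pub-gaugeboot`, page 1 of every file): the venture produces certified bounds
on lattice expectations at stated coupling, gauge group, dimension and torus size; NOT a mass gap,
NOT a continuum limit, NOT a string tension; NOT Yang–Mills-summit-bearing (barriers
`FixedCouplingUltralocality`, `PerturbativeInvisibility`).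

`TiltedBoxAxisFlips.lean` proves reflection positivity in the ANTI-DIAGONAL hyperplane
`x_i = -x_j` on the SQUARE tilted box only (`M_u = M_v`; there the mirror is the diagonal mirror
conjugated by the flip `x_j ↦ -x_j`, a symmetry of `Γ` iff `M_u = M_v`). But the anti-diagonal mirror
`ψ : x_i ↦ -x_j, x_j ↦ -x_i` itself is a symmetry of EVERY tilted lattice `Γ(M_u, M_v, L)` (it sends
`x_i + x_j ↦ -(x_i + x_j)` and fixes `x_i - x_j`); it is not a tilted diagonal frame for the marked
translations `e` (`ψ(e_i) = -e_j`), but it IS one for the presentation `e' = revAxis e j` with the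
`j`-axis reversed (`TiltedLatticeAxisReversal.lean`): `ψ(e'_i) = e'_j`, `ψ(e'_j) = e'_i`, height
`x_i + x_j (mod 2M_u)`, both layers `x_i + x_j ≡ 0, M_u` pointwise fixed. So the tree's abstract
theorem `IsTiltedFrame.integral_conj_mul_nonneg` applies to `(A, e')`, and the identification
`revConfig` of the two presentations carries it back:

* `antiHom`, `tiltedAntiMirror` (`ψ` on the box), `tiltedAntiHeight` (`x_i + x_j mod 2M_u`, the
  general-box version of `tiltedSum`), `isTiltedFrame_antiDiag` (needs `M_u ≥ 2`);
* `configAntiSwap` — the induced reflection of configurations: `k`-links (`k ∉ {i, j}`) carried to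
  `ψx`, the `i`-link at `x` to the `j`-link INTO `ψx` reversed and inverted, and symmetrically
  (`configAntiSwap_other/_left/_right`);
* **`tiltedBox_antiDiagonalRP_general`** — for compact second countable `G`, continuous `ρ`,
  `β ≥ 0`, `i ≠ j`, `M_u ≥ 2`, ANY `M_v ≥ 1`, `L ≥ 1`, and every bounded measurable `F` depending only
  on the links with both endpoints in `{0 ≤ x_i + x_j ≤ M_u (mod 2M_u)}`:
  `0 ≤ ∫ conj F(Θ U) · F(U) dμ_β`. The positivity cone of a non-square tilted box thus also
  contains the anti-diagonal family (t1 v2.5 A6(iii)/A15 listed it for square boxes only).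

References: J. Fröhlich, R. Israel, E. H. Lieb, B. Simon, J. Stat. Phys. 22 (1980) 297, §3;
M. Biskup, in LNM 1970 (2009) §5.4 (both diagonals on the diagonal torus); K. Osterwalder,
E. Seiler, Ann. Phys. 110 (1978) 440, §2.
-/

noncomputable section

open MeasureTheory Complex QuotientAddGroup
open scoped ComplexOrder ComplexConjugate

namespace Summit.QuantumFields.GaugeBoot

namespace TiltedRP

/-! ## The anti-diagonal mirror of the box -/

section Box

variable (d : ℕ) (i j : Fin d) (Mu Mv L : ℕ)

/-- `x ↦ (x_i ↦ -x_j, x_j ↦ -x_i)` on `ℤ^d`. [folklore] -/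
def antiHom : (Fin d → ℤ) →+ (Fin d → ℤ) :=
  (negHom d i).comp ((negHom d j).comp (swapHom d i j))

variable {d i j}

/-- `antiHom` evaluated. [folklore] -/
theorem antiHom_apply (hij : i ≠ j) (x : Fin d → ℤ) (m : Fin d) :
    antiHom d i j x m = if m = i then -x j else if m = j then -x i else x m := by
  simp only [antiHom, AddMonoidHom.coe_comp, Function.comp_apply, negHom_apply, swapHom_apply]
  by_cases hmi : m = i
  · subst hmi; simp [hij]
  · by_cases hmj : m = j
    · subst hmj; simp [hmi]
    · simp [hmi, hmj, Equiv.swap_apply_of_ne_of_ne hmi hmj]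

/-- `antiHom` is an involution. [folklore] -/
theorem antiHom_antiHom (hij : i ≠ j) (x : Fin d → ℤ) : antiHom d i j (antiHom d i j x) = x := by
  funext m
  by_cases hmi : m = i
  · subst hmi
    rw [antiHom_apply hij, if_pos rfl, antiHom_apply hij, if_neg hij.symm, if_pos rfl, neg_neg]
  · by_cases hmj : m = j
    · subst hmj
      rw [antiHom_apply hij, if_neg hmi, if_pos rfl, antiHom_apply hij, if_pos rfl, neg_neg]
    · rw [antiHom_apply hij, if_neg hmi, if_neg hmj, antiHom_apply hij, if_neg hmi, if_neg hmj]

variable (d i j) in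
/-- `Γ(M_u, M_v, L)` is invariant under the anti-diagonal mirror, for EVERY `M_u, M_v`. [folklore] -/
theorem tiltedLattice_le_comap_antiHom (hij : i ≠ j) :
    tiltedLattice d i j Mu Mv L ≤ (tiltedLattice d i j Mu Mv L).comap (antiHom d i j) := by
  intro x hx
  rw [AddSubgroup.mem_comap, mem_tiltedLattice_iff]
  rw [mem_tiltedLattice_iff] at hx
  obtain ⟨h1, h2, h3⟩ := hx
  simp only [antiHom_apply hij, if_true, if_neg hij.symm]
  refine ⟨?_, ?_, fun m hmi hmj => ?_⟩
  · rw [show -x j + -x i = -(x i + x j) by ring]; exact h1.neg_right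
  · rw [show -x j - -x i = x i - x j by ring]; exact h2
  · rw [if_neg hmi, if_neg hmj]; exact h3 m hmi hmj

variable (d i j) in
/-- **The anti-diagonal mirror of the tilted box**: `[x] ↦ [(x_i ↦ -x_j, x_j ↦ -x_i)]`. [folklore] -/
def tiltedAntiMirror (hij : i ≠ j) : TiltedSite d i j Mu Mv L →+ TiltedSite d i j Mu Mv L :=
  QuotientAddGroup.map _ _ (antiHom d i j) (tiltedLattice_le_comap_antiHom d i j Mu Mv L hij)

/-- The anti-diagonal mirror on classes. [folklore] -/
theorem tiltedAntiMirror_mk (hij : i ≠ j) (x : Fin d → ℤ) :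
    tiltedAntiMirror d i j Mu Mv L hij (x : TiltedSite d i j Mu Mv L) =
      ((antiHom d i j x : Fin d → ℤ) : TiltedSite d i j Mu Mv L) := rfl

variable (d i j) in
/-- **The anti-height of the box**: `[x] ↦ x_i + x_j mod 2M_u` (general-box version of `tiltedSum`).
[folklore] -/
def tiltedAntiHeight : TiltedSite d i j Mu Mv L →+ ZMod (2 * Mu) :=
  QuotientAddGroup.lift _ (sumHom d i j Mu) (by
    intro x hx
    rw [mem_tiltedLattice_iff_cast] at hx
    rw [AddMonoidHom.mem_ker]
    simpa [sumHom] using hx.1)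

/-- The anti-height on classes. [folklore] -/
theorem tiltedAntiHeight_mk (x : Fin d → ℤ) :
    tiltedAntiHeight d i j Mu Mv L (x : TiltedSite d i j Mu Mv L) = ((x i + x j : ℤ) : ZMod (2 * Mu)) := by
  show sumHom d i j Mu x = _
  simp [sumHom]

/-- **Both layers `x_i + x_j ≡ 0` and `≡ M_u (mod 2M_u)` are pointwise fixed by the anti-diagonal
mirror**: `x - ψx = (x_i + x_j)(e_i + e_j) ∈ Γ` as soon as `M_u ∣ x_i + x_j`. [folklore] -/
theorem tiltedAntiMirror_eq_self_of_layer (hij : i ≠ j) (q : TiltedSite d i j Mu Mv L)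
    (hq : tiltedAntiHeight d i j Mu Mv L q = 0 ∨
      tiltedAntiHeight d i j Mu Mv L q = ((Mu : ℕ) : ZMod (2 * Mu))) :
    tiltedAntiMirror d i j Mu Mv L hij q = q := by
  induction q using QuotientAddGroup.induction_on with
  | H x =>
    rw [tiltedAntiMirror_mk, QuotientAddGroup.eq, mem_tiltedLattice_iff]
    rw [tiltedAntiHeight_mk] at hq
    have hdvd : (Mu : ℤ) ∣ x i + x j := by
      rcases hq with h | h
      · have h' := (ZMod.intCast_zmod_eq_zero_iff_dvd _ _).1 h
        exact (Dvd.intro 2 (by push_cast; ring) : (Mu : ℤ) ∣ ((2 * Mu : ℕ) : ℤ)).trans h'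
      · have h' : (((x i + x j - Mu : ℤ)) : ZMod (2 * Mu)) = 0 := by
          rw [Int.cast_sub, h, Int.cast_natCast, sub_self]
        have h'' := (ZMod.intCast_zmod_eq_zero_iff_dvd _ _).1 h'
        have h3 : (Mu : ℤ) ∣ x i + x j - Mu :=
          (Dvd.intro 2 (by push_cast; ring) : (Mu : ℤ) ∣ ((2 * Mu : ℕ) : ℤ)).trans h''
        simpa using h3.add (dvd_refl (Mu : ℤ))
    simp only [Pi.add_apply, Pi.neg_apply, antiHom_apply hij, if_true, if_neg hij.symm]
    refine ⟨?_, ?_, fun m hmi hmj => ?_⟩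
    · rw [show -(-x j) + x i + (-(-x i) + x j) = 2 * (x i + x j) by ring]
      push_cast
      exact mul_dvd_mul_left 2 hdvd
    · rw [show -(-x j) + x i - (-(-x i) + x j) = 0 by ring]; exact dvd_zero _
    · rw [if_neg hmi, if_neg hmj, neg_add_cancel]; exact dvd_zero _

/-- **The anti-diagonal mirror is a tilted diagonal frame of the reversed presentation**
`e' = revAxis tiltedUnit j` (height `x_i + x_j mod 2M_u`; needs `M_u ≥ 2`, any `M_v`). [folklore] -/
theorem isTiltedFrame_antiDiag [NeZero Mu] (hij : i ≠ j) (hMu : 2 ≤ Mu) :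
    IsTiltedFrame (revAxis (tiltedUnit d i j Mu Mv L) j) i j (tiltedAntiMirror d i j Mu Mv L hij) Mu
      (tiltedAntiHeight d i j Mu Mv L) := by
  haveI : NeZero (2 * Mu) := ⟨by have := NeZero.ne Mu; omega⟩
  -- the mirror on the unit vectors
  have hsi : antiHom d i j (Pi.single i (1 : ℤ)) = -Pi.single j (1 : ℤ) := by
    funext m; rw [antiHom_apply hij, Pi.neg_apply]
    by_cases hmi : m = i
    · subst hmi
      rw [if_pos rfl, Pi.single_eq_of_ne hij.symm, Pi.single_eq_of_ne hij, neg_zero]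
    · by_cases hmj : m = j
      · subst hmj
        rw [if_neg hmi, if_pos rfl, Pi.single_eq_same, Pi.single_eq_same]
      · rw [if_neg hmi, if_neg hmj, Pi.single_eq_of_ne hmi, Pi.single_eq_of_ne hmj, neg_zero]
  have hsj : antiHom d i j (Pi.single j (1 : ℤ)) = -Pi.single i (1 : ℤ) := by
    funext m; rw [antiHom_apply hij, Pi.neg_apply]
    by_cases hmi : m = i
    · subst hmi
      rw [if_pos rfl, Pi.single_eq_same, Pi.single_eq_same]
    · by_cases hmj : m = j
      · subst hmj
        rw [if_neg hmi, if_pos rfl, Pi.single_eq_of_ne hij, Pi.single_eq_of_ne hij.symm, neg_zero]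
      · rw [if_neg hmi, if_neg hmj, Pi.single_eq_of_ne hmj, Pi.single_eq_of_ne hmi, neg_zero]
  have hso : ∀ k, k ≠ i → k ≠ j → antiHom d i j (Pi.single k (1 : ℤ)) = Pi.single k (1 : ℤ) := by
    intro k hki hkj; funext m; rw [antiHom_apply hij]
    by_cases hmi : m = i
    · subst hmi
      rw [if_pos rfl, Pi.single_eq_of_ne (Ne.symm hkj), Pi.single_eq_of_ne (Ne.symm hki), neg_zero]
    · by_cases hmj : m = j
      · subst hmj
        rw [if_neg hmi, if_pos rfl, Pi.single_eq_of_ne (Ne.symm hki), Pi.single_eq_of_ne (Ne.symm hkj),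
          neg_zero]
      · rw [if_neg hmi, if_neg hmj]
  have hmk : ∀ y : Fin d → ℤ, ((y : Fin d → ℤ) : TiltedSite d i j Mu Mv L) =
      QuotientAddGroup.mk' (tiltedLattice d i j Mu Mv L) y := fun y => rfl
  refine
    { ne := hij
      two_le := hMu
      map_e := fun k => ?_
      invol := fun q => ?_
      height_left := ?_
      height_right := ?_
      height_other := fun k hki hkj => ?_
      height_map := fun q => ?_
      fix_of_layer := fun q hq => tiltedAntiMirror_eq_self_of_layer Mu Mv L hij q hq }
  · -- `ψ (e' k) = e' ((i j) k)`
    by_cases hki : k = i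
    · subst hki
      rw [revAxis_of_ne _ hij, Equiv.swap_apply_left, revAxis_self, tiltedUnit, tiltedUnit,
        tiltedAntiMirror_mk, hsi, hmk, hmk, map_neg]
    · by_cases hkj : k = j
      · subst hkj
        rw [revAxis_self, Equiv.swap_apply_right, revAxis_of_ne _ (Ne.symm hki), map_neg, tiltedUnit,
          tiltedUnit, tiltedAntiMirror_mk, hsj, hmk, hmk, map_neg, neg_neg]
      · rw [revAxis_of_ne _ hkj, Equiv.swap_apply_of_ne_of_ne hki hkj, revAxis_of_ne _ hkj, tiltedUnit,
          tiltedAntiMirror_mk, hso k hki hkj]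
  · induction q using QuotientAddGroup.induction_on with
    | H x => rw [tiltedAntiMirror_mk, tiltedAntiMirror_mk, antiHom_antiHom hij]
  · rw [revAxis_of_ne _ hij, tiltedUnit, tiltedAntiHeight_mk, Pi.single_eq_same, Pi.single_eq_of_ne hij.symm,
      add_zero, Int.cast_one]
  · rw [revAxis_self, map_neg, tiltedUnit, tiltedAntiHeight_mk, Pi.single_eq_of_ne hij, Pi.single_eq_same,
      zero_add, Int.cast_one]
  · rw [revAxis_of_ne _ hkj, tiltedUnit, tiltedAntiHeight_mk, Pi.single_eq_of_ne (Ne.symm hki),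
      Pi.single_eq_of_ne (Ne.symm hkj), add_zero, Int.cast_zero]
  · induction q using QuotientAddGroup.induction_on with
    | H x =>
      rw [tiltedAntiMirror_mk, tiltedAntiHeight_mk, tiltedAntiHeight_mk, antiHom_apply hij,
        antiHom_apply hij, if_pos rfl, if_neg hij.symm, if_pos rfl]
      push_cast
      ring

end Box

/-! ## The induced reflection of configurations and the theorem -/

section Main

variable {d : ℕ} {i j : Fin d} {Mu Mv L N : ℕ}
variable {G : Type*} [Group G]

/-- **The anti-diagonal reflection of configurations** of the tilted box: the diagonal swap of the
reversed presentation, read back in the original one. Explicitly (`configAntiSwap_other/_left/_right`):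
`k`-links (`k ∉ {i, j}`) are carried to `ψx`; the `i`-link at `x` becomes the `j`-link into `ψx`
reversed and inverted, and symmetrically. [folklore] -/
def configAntiSwap (hij : i ≠ j) (U : Config (TiltedSite d i j Mu Mv L) d G) :
    Config (TiltedSite d i j Mu Mv L) d G :=
  revConfig (revAxis (tiltedUnit d i j Mu Mv L) j) j
    (configSwap i j (tiltedAntiMirror d i j Mu Mv L hij) (revConfig (tiltedUnit d i j Mu Mv L) j U))

/-- `configAntiSwap` on a `k`-link, `k ∉ {i, j}`. [folklore] -/
theorem configAntiSwap_other (hij : i ≠ j) (U : Config (TiltedSite d i j Mu Mv L) d G)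
    (x : TiltedSite d i j Mu Mv L) {k : Fin d} (hki : k ≠ i) (hkj : k ≠ j) :
    configAntiSwap hij U (x, k) = U (tiltedAntiMirror d i j Mu Mv L hij x, k) := by
  rw [configAntiSwap, revConfig_other _ _ _ _ hkj, configSwap_apply, linkSwap_mk,
    Equiv.swap_apply_of_ne_of_ne hki hkj, revConfig_other _ _ _ _ hkj]

/-- `configAntiSwap` on an `i`-link: the `j`-link `ψx - e_j → ψx`, inverted. [folklore] -/
theorem configAntiSwap_left (hij : i ≠ j) (U : Config (TiltedSite d i j Mu Mv L) d G)
    (x : TiltedSite d i j Mu Mv L) :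
    configAntiSwap hij U (x, i) =
      (U (tiltedAntiMirror d i j Mu Mv L hij x - tiltedUnit d i j Mu Mv L j, j))⁻¹ := by
  rw [configAntiSwap, revConfig_other _ _ _ _ hij, configSwap_apply, linkSwap_mk, Equiv.swap_apply_left,
    revConfig_self]

/-- `configAntiSwap` on a `j`-link: the `i`-link `ψx - e_i → ψx`, inverted. [folklore] -/
theorem configAntiSwap_right [NeZero Mu] (hij : i ≠ j) (hMu : 2 ≤ Mu) (U : Config (TiltedSite d i j Mu Mv L) d G)
    (x : TiltedSite d i j Mu Mv L) :
    configAntiSwap hij U (x, j) =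
      (U (tiltedAntiMirror d i j Mu Mv L hij x - tiltedUnit d i j Mu Mv L i, i))⁻¹ := by
  have hF := isTiltedFrame_antiDiag Mu Mv L hij hMu
  rw [configAntiSwap, revConfig_self, revAxis_self, sub_neg_eq_add, configSwap_apply, linkSwap_mk,
    Equiv.swap_apply_right, map_add, revConfig_other _ _ _ _ hij]
  have h := hF.map_e j
  rw [revAxis_self, map_neg, Equiv.swap_apply_right, revAxis_of_ne _ hij] at h
  rw [neg_eq_iff_eq_neg.1 h, ← sub_eq_add_neg]

variable {α : Type*}

/-- Half observables of `(A, e)` become half observables of the reversed presentation `(A, e')` under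
`revConfig e' j` (the `e'`-link `(x + e_j, j)` has the endpoints of the `e`-link `(x, j)`). [folklore] -/
theorem isHalfObservable_comp_revConfig {A : Type*} [AddCommGroup A] (e : Fin d → A) (j : Fin d) {P : ℕ}
    (v : A →+ ZMod (2 * P)) {F : Config A d G → α} (hFo : IsHalfObservable e P v F) :
    IsHalfObservable (revAxis e j) P v (fun V => F (revConfig (revAxis e j) j V)) := by
  intro V V' hVV'
  apply hFo
  rintro ⟨x, m⟩ hl
  by_cases hm : m = j
  · subst hm
    rw [revConfig_self, revConfig_self, revAxis_self, sub_neg_eq_add]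
    congr 1
    refine hVV' (x + e m, m) ⟨hl.2, ?_⟩
    show InHalf P v (x + e m + revAxis e m m)
    rw [revAxis_self, add_neg_cancel_right]
    exact hl.1
  · rw [revConfig_other _ _ _ _ hm, revConfig_other _ _ _ _ hm]
    refine hVV' (x, m) ⟨hl.1, ?_⟩
    show InHalf P v (x + revAxis e j m)
    rw [revAxis_of_ne _ hm]
    exact hl.2

variable [TopologicalSpace G] [IsTopologicalGroup G] [CompactSpace G] [MeasurableSpace G] [BorelSpace G]
  [SecondCountableTopology G] (ρ : G →* Matrix (Fin N) (Fin N) ℂ)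

/-- **Anti-diagonal reflection positivity of lattice Yang–Mills on EVERY 45°-tilted periodic box.**
For compact second countable `G`, continuous `ρ`, `β ≥ 0`, `i ≠ j`, `M_u ≥ 2` (any `M_v, L ≥ 1`) and
every bounded measurable `F` depending only on the links with both endpoints in
`{0 ≤ x_i + x_j ≤ M_u (mod 2M_u)}`: `0 ≤ ∫ conj F(Θ U) · F(U) dμ_β`, `Θ = configAntiSwap` the
reflection in the anti-diagonal hyperplane `x_i = -x_j`. (For `M_u = M_v` this is
`tiltedBox_antiDiagonalRP` of `TiltedBoxAxisFlips.lean` up to the presentation of `Θ`.) [folklore] -/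
theorem tiltedBox_antiDiagonalRP_general [NeZero Mu] [NeZero Mv] [NeZero L] (hij : i ≠ j) (hMu : 2 ≤ Mu)
    (hρ : Continuous ρ) {β : ℝ}
    (hβ : 0 ≤ β) (F : Config (TiltedSite d i j Mu Mv L) d G → ℂ) (hFm : Measurable F)
    (hFb : ∃ C : ℝ, ∀ U, ‖F U‖ ≤ C)
    (hFo : IsHalfObservable (tiltedUnit d i j Mu Mv L) Mu (tiltedAntiHeight d i j Mu Mv L) F) :
    0 ≤ ∫ U, conj (F (configAntiSwap hij U)) * F U ∂(gibbs ρ (tiltedUnit d i j Mu Mv L) β) := by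
  set e := tiltedUnit d i j Mu Mv L with he
  set ψ := tiltedAntiMirror d i j Mu Mv L hij with hψ
  have hF := isTiltedFrame_antiDiag Mu Mv L hij hMu
  -- the observable read in the reversed presentation
  have hGm : Measurable fun V => F (revConfig (revAxis e j) j V) :=
    hFm.comp (measurable_revConfig (revAxis e j) j)
  have hGb : ∃ C : ℝ, ∀ V, ‖F (revConfig (revAxis e j) j V)‖ ≤ C := by
    obtain ⟨C, hC⟩ := hFb; exact ⟨C, fun V => hC _⟩
  have hGo := isHalfObservable_comp_revConfig e j (tiltedAntiHeight d i j Mu Mv L) hFo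
  have h := hF.integral_conj_mul_nonneg ρ hρ hβ (fun V => F (revConfig (revAxis e j) j V)) hGm hGb hGo
  have h3 : ∫ U, conj (F (configAntiSwap hij U)) * F U ∂(gibbs ρ e β) =
      ∫ V, conj (F (revConfig (revAxis e j) j (configSwap i j ψ V))) * F (revConfig (revAxis e j) j V)
        ∂(gibbs ρ (revAxis e j) β) := by
    rw [← integral_comp_revConfig_gibbs_complex ρ hρ e j β
      (fun V => conj (F (revConfig (revAxis e j) j (configSwap i j ψ V))) * F (revConfig (revAxis e j) j V))]
    refine integral_congr_ae (ae_of_all _ fun U => ?_)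
    simp only [configAntiSwap, revConfig_revConfig, he, hψ]
  rw [h3]
  exact h

end Main

end TiltedRP

end Summit.QuantumFields.GaugeBoot
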